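import Literature.Analysis.ValidatedNumerics.TaylorModelQuadrature
import Literature.Analysis.ValidatedNumerics.ExpPoly.SecondDifference
import HarnessLib

/-!
# Exact-rational sign cells for a rational polynomial on an interval

Trunk T-ANA (Analysis/ValidatedNumerics); namespace `Literature.Analysis.ValidatedNumerics.ExpPoly.Poly`.
A kernel-decidable (`decide +kernel`) POSITIVITY CHECK for a polynomial with rational coefficients
(`ExpPoly.Poly = List ℚ`, Horner evaluation `Poly.eval : Poly → ℝ → ℝ` of `ExpPoly/Poly.lean`) on a closed
interval with rational endpoints, in EXACT rational arithmetic — the exact twin of the interval checker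
`PolyMP.posOn` of `IntervalPolynomial.lean` (midpoint Taylor shift + absolute tail bound), for certificates whose
polynomials have huge, violently cancelling coefficients (there the fixed-point interval arithmetic of `PolyMP` is
needlessly expensive in the kernel, while exact rationals are cheap):

* `posCore p lo hi` (with `Poly.taylorShift p c = p(c + ·)` of `ExpPoly/SecondDifference.lean`) — Taylor-shift to the midpoint `m`, half-width `w`, and test `w · absBoundQ tail w < p(m)`
  (`absBoundQ` of `TaylorModelQuadrature.lean`); `posCore_sound`: then `p > 0` on `[lo, hi]`;
* `posCells p pts` — `posCore` on every consecutive pair of the breakpoint list `pts` (the cells of a cover,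
  found offline by bisection); `posCells_sound`: then `p > 0` on `[pts.head, pts.last]`.

Problem-independent; no facts, no axioms; everything computable and structurally recursive. Written for the
E-010 detector certificates of the Landau–Siegel programme (cell landau-siegel §E), usable anywhere.

## References

* R. E. Moore, *Interval Analysis*, Prentice-Hall 1966, Ch. 3 (centred forms, subdivision). [folklore]
* R. E. Moore, *Methods and Applications of Interval Analysis*, SIAM 1979, Sect. 2.2. [cite: Moore1979, Sect. 2.2]
-/

namespace Literature.Analysis.ValidatedNumerics

namespace ExpPoly

namespace Poly

open Literature.Analysis.ValidatedNumerics.PolyMP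

/-! ### One cell: centred evaluation and absolute tail bound -/

/-- Core test on `[lo, hi]`: with `m = (lo+hi)/2`, `w = (hi−lo)/2` and `p(m + y) = s₀ + y·t(y)`, accept iff
`w · absBoundQ t w < s₀` (exact rational arithmetic). [cite: Moore1979, Sect. 2.2] -/
def posCore (p : Poly) (lo hi : ℚ) : Bool :=
  match taylorShift p ((lo + hi) / 2) with
  | [] => false
  | s0 :: tail => decide ((hi - lo) / 2 * absBoundQ tail ((hi - lo) / 2) < s0)

/-- **Soundness of the core test**: `posCore p lo hi = true` implies `p > 0` on `[lo, hi]`.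
[cite: Moore1979, Sect. 2.2] -/
theorem posCore_sound {p : Poly} {lo hi : ℚ} (h : posCore p lo hi = true) {x : ℝ}
    (hlo : (lo : ℝ) ≤ x) (hhi : x ≤ hi) : 0 < eval p x := by
  unfold posCore at h
  split at h
  · exact absurd h (by simp)
  · rename_i s0 tail hs
    have hlt : (((hi - lo) / 2 * absBoundQ tail ((hi - lo) / 2) : ℚ) : ℝ) < ((s0 : ℚ) : ℝ) := by
      exact_mod_cast of_decide_eq_true h
    set y : ℝ := x - (((lo + hi) / 2 : ℚ) : ℝ) with hy
    have hyb : |y| ≤ (((hi - lo) / 2 : ℚ) : ℝ) := by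
      rw [hy, abs_le]; push_cast; constructor <;> linarith
    have hw : (0 : ℝ) ≤ (((hi - lo) / 2 : ℚ) : ℝ) := (abs_nonneg y).trans hyb
    have hev : eval p x = (s0 : ℝ) + y * eval tail y := by
      have e := eval_taylorShift p ((lo + hi) / 2) y
      rw [hs, eval_cons] at e
      rw [show x = ((((lo + hi) / 2 : ℚ)) : ℝ) + y by rw [hy]; ring, ← e]
    have htail : |y * eval tail y| ≤ (((hi - lo) / 2 : ℚ) : ℝ) * ((absBoundQ tail ((hi - lo) / 2) : ℚ) : ℝ) := by
      rw [abs_mul]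
      exact mul_le_mul hyb (abs_eval_le_absBoundQ tail hyb) (abs_nonneg _) hw
    have hlow : -((((hi - lo) / 2 : ℚ) : ℝ) * ((absBoundQ tail ((hi - lo) / 2) : ℚ) : ℝ)) ≤ y * eval tail y :=
      (abs_le.1 htail).1
    push_cast at hlt hlow ⊢
    rw [hev]
    linarith

/-! ### A cover of the interval by cells -/

/-- `posCore` on every consecutive pair of breakpoints. [cite: Moore1979, Sect. 2.2] -/
def posCells (p : Poly) : List ℚ → Bool
  | a :: b :: rest => posCore p a b && posCells p (b :: rest)
  | _ => true

/-- **Soundness of the cell cover**: if `posCells p (a :: b :: rest) = true` then `p > 0` on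
`[a, last (b :: rest)]`. (No ordering hypothesis is needed: a point not in the first cell lies beyond its right end.)
[cite: Moore1979, Sect. 2.2] -/
theorem posCells_sound {p : Poly} :
    ∀ (rest : List ℚ) (a b : ℚ), posCells p (a :: b :: rest) = true →
      ∀ {x : ℝ}, (a : ℝ) ≤ x → x ≤ (((b :: rest).getLast (List.cons_ne_nil b rest) : ℚ) : ℝ) → 0 < eval p x
  | [], a, b, h, x, hlo, hhi => by
      simp only [posCells, Bool.and_true] at h
      simp only [List.getLast_singleton] at hhi
      exact posCore_sound h hlo hhi
  | c :: rest, a, b, h, x, hlo, hhi => by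
      rw [posCells, Bool.and_eq_true] at h
      rcases le_or_gt x (b : ℝ) with hxb | hxb
      · exact posCore_sound h.1 hlo hxb
      · have hlast : ((b :: c :: rest).getLast (List.cons_ne_nil b _) : ℚ)
            = (c :: rest).getLast (List.cons_ne_nil c rest) := by
          simp [List.getLast_cons]
        rw [hlast] at hhi
        exact posCells_sound rest b c h.2 hxb.le hhi

/-- Convenience form on `[lo, hi]`: the breakpoint list starts at `lo` and ends at `hi`.
[cite: Moore1979, Sect. 2.2] -/
theorem pos_of_posCells {p : Poly} {lo hi : ℚ} {mid : List ℚ} (h : posCells p (lo :: (mid ++ [hi])) = true)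
    {x : ℝ} (hlo : (lo : ℝ) ≤ x) (hhi : x ≤ hi) : 0 < eval p x := by
  cases mid with
  | nil =>
      exact posCells_sound [] lo hi h hlo (by simpa using hhi)
  | cons b rest =>
      refine posCells_sound (rest ++ [hi]) lo b h hlo ?_
      rw [show ((b :: (rest ++ [hi])).getLast (List.cons_ne_nil b _) : ℚ) = hi by simp]
      exact hhi

end Poly

end ExpPoly

end Literature.Analysis.ValidatedNumerics
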